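import Summits.HodgeConjecture.HodgeConjecture.Theorems.F0P3cStCharTSPrincipalSeriesUnitary   -- ★ p852355 (this seat) «PS-UNITARY★»: `isSemisimpleRepresentation_cmPrincipalSeries_cmTorusCharPair`
import Summits.HodgeConjecture.HodgeConjecture.Theorems.F0P3U3PrincipalSeriesLettersHold      -- ★ N2 `u3PrincipalSeriesConstituentEmbeds_holds`, N3 `u3PrincipalSeriesLengthLeTwo_holds`
import Summits.HodgeConjecture.HodgeConjecture.Theorems.F0P3U3LengthLeTwoOfEmbeds             -- ★ `nontrivial_coinvariants_of_isConstituentOf_cmPrincipalSeries`, `isSmooth_cmPrincipalSeries`; brings ★ `isLimitOfCompactOpen_cmUnipotentU`, N1 unfold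
import Summits.HodgeConjecture.HodgeConjecture.Theorems.F0P3U3PrincipalSeriesJacquetFiltrationHolds  -- ★ N1 `U3PrincipalSeriesJacquetFiltration_holds` (`dim r_B i_G(χ) = 2`)
import Summits.HodgeConjecture.HodgeConjecture.Theorems.F0P2pCmPrincipalSeriesInterface        -- ★ p829948 (F0P2-p06 (g0)) Frobenius uniqueness `intertwiningMap_cmPrincipalSeries_eq_smul`
import Summits.HodgeConjecture.HodgeConjecture.Theorems.F0P3cStCharTSUniqPar                   -- ★ p851567 (LH6-p02 (g5)) the converse: `exists_ne_bot_ne_top_of_isConstituentOf_ne` (via ★ PrincipalSeriesTrace)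
import Literature.NumberTheory.Automorphic.JacquetRankStrictMono                               -- ★ `Representation.finrank_coinvariants_eq_one_of_ne_bot_of_ne_top` [Casselman1995, Prop. 7.1.3]
import HarnessLib

/-!
# F0 · P3c · line LH6 «StCharTS» — «LDS-RED-TWO ⟸ KEYS-RED-(3)★»: a REDUCIBLE semi-regular unitary principal series `i_G(χ₁, χ₂)` of `U(Φ₃)(L⁺_v)`
# (`χ₁|_{F_v^×} = 1`) has TWO NON-ISOMORPHIC constituents — RUNG 0's named input `hLdsRedTwo` re-lettered to Keys' reducibility statement ALONE
# (Rogawski 1990, §12.2 p. 173 ll. 8–12 and (3) pp. 173–174; Keys 1984, §7 Thm. (1); Casselman 1995, Prop. 7.1.3, Cor. 7.1.2; Bernstein–Zelevinsky 1976, 2.25 (c); 1977, Prop. 1.9)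

Cell `pub/hodgecm-mathlib`, crux H413 = `stmt-HodgeConjecture-24833` (lane `--supports … --as helper`), route HCCMUnconditional; seat F0P2-p06 (g19), DEFAULT brick
«LDS-RED-TWO ⟸ KEYS-RED-(3)» FILE 2 (announced F0∕P2 + cell + F0∕P3b 2026-09-02T18:2xZ).  THEOREMS ONLY (no definition ∕ instance ∕ notation ∕ named fact ∕ `sorry`); ★-only imports.

WHAT.  `G = Gqs L v = U(Φ₃)(L⁺_v)`, `v` NON-SPLIT (`hns`), `χ = (χ₁, χ₂)` continuous characters in the PAIR currency (★ `cmTorusCharPair`) with `χ₁|_{F_v^×} = 1` (the semi-regular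
unitary point of [Rogawski1990, §12.2 (3)]: `wχ = χ`), `I = i_G(χ)` = ★ `cmPrincipalSeries L 3 v (cmTorusCharPair L v χ₁ χ₂)`.  RUNG 0 (★ `F0P3cStCharTSRung0Five`, outer binder
`hLdsRedTwo`, :129) takes as a NAMED INPUT «for `χ₁ ≠ 1` such an `I` has two DISTINCT constituents» = (R1) Keys' reducibility + (R2) inequivalence of the two constituents
(census `F0/P3b/LH6-p02/g7/CENSUS-hLdsTwo.v1.LH6p02g7.md`, §«(R2) ⟸ (R1) + (U) + Frobenius★ + N1★»).  With (U) now ★ (FILE 1 «PS-UNITARY★»), THIS FILE proves (R2) in-house: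
* §1 **`intertwiningMap_eq_smul_of_finrank_eq_one`** (linear algebra): two `M`-maps out of a ONE-dimensional representation into a one-dimensional one are proportional.
* §2 **`two_constituents_of_reducible`** — if `I` is reducible (`∃ N, ⊥ ≠ N ≠ ⊤`) then `I` has two DISTINCT constituents.  Proof: `I` is semisimple (★ FILE 1), so `N` has an
  invariant complement `N'` (`⊥ ≠ N' ≠ ⊤`); `I` has no 3-chain (★ N3 `u3PrincipalSeriesLengthLeTwo_holds`), so `N` and `N'` are irreducible (★
  `IrrClass.isIrreducible_toRepresentation_of_forall_not_lt_lt`) and their classes `⟦N⟧`, `⟦N'⟧` are constituents (★ `IsConstituentOf.of_subrepresentation`).  If `⟦N⟧ = ⟦N'⟧`,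
  an equivalence `e : N ≃ N'` gives a SECOND embedding `N ↪ N' ↪ I` besides the inclusion; but `dim r_B(N) = 1` (★ `Representation.finrank_coinvariants_eq_one_of_ne_bot_of_ne_top`
  [Casselman1995, Prop. 7.1.3] over ★ N1 `dim r_B(I) = 2`, ★ N2 «every constituent has `r_B ≠ 0`», ★ `isLimitOfCompactOpen_cmUnipotentU`), so `Hom_M(r_B(N), ℂ_χ)` is a line (§1)
  and FROBENIUS UNIQUENESS (★ `intertwiningMap_cmPrincipalSeries_eq_smul` [BernsteinZelevinsky1977, Prop. 1.9 (b)]) makes the two embeddings proportional: `e(n) = c·n ∈ N ⊓ N' = 0`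
  for every `n ∈ N` — absurd, `e` being injective on `N ≠ 0`.
* §3 **`ldsRedTwo_of_keysRedThree`** — RUNG 0's `hLdsRedTwo` binder text (★ `…Rung0Five` :129, VERBATIM) FROM the re-lettered named input «KEYS-RED-(3)»
  `∀ χ₁ χ₂ continuous, (∀ a, σ a = a → χ₁ a = 1) → χ₁ ≠ 1 → ∃ N : Subrepresentation (i_G(χ₁, χ₂)), N ≠ ⊥ ∧ N ≠ ⊤` = [Keys1984 §7 Thm. (1)] case (3), ⇐-half, ALONE (the
  antecedent shape of RUNG 0's `hKeysRed`); and the converse **`keysRedThree_of_ldsRedTwo`** (★ `exists_ne_bot_ne_top_of_isConstituentOf_ne`): the re-lettering is an `Iff`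
  (**`ldsRedTwo_iff_keysRedThree`**), hence honesty-neutral.  RUNG 0 v6+ may write `hLdsRedTwo := ldsRedTwo_of_keysRedThree L v hns hKeysRed3`.
HONEST LABEL: HC_CM is proved only modulo the 7 printed citations (2 remaining named inputs: hLiu418 = `stmt-HodgeConjecture-24832`, h413 = `stmt-HodgeConjecture-24833`) until rung 0
closes; this file closes no organ — it SHRINKS the print residue of «LDS-TWO» from (R1)+(R2) to (R1) (count-neutral helper).

## References
* [Rogawski1990] J. D. Rogawski, *Automorphic Representations of Unitary Groups in Three Variables*, Ann. of Math. Stud. 123 (1990), §12.1 p. 171; §12.2 p. 173 ll. 8–12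
  («If `i_G(χ)` is reducible, it contains exactly two irreducible constituents … (3) `χ₁` is non-trivial and `χ₁|F*` is trivial»), (3) pp. 173–174 («the two elements of
  `JH(i_B(θ̃))` make up an l.d.s. L-packet … a unique element … possesses a Whittaker model»).
* [Keys1984] D. Keys, *Principal series representations of special unitary groups over local fields*, Compositio Math. 51 (1984), §7 Thm. (1) p. 126.
* [Casselman1995] W. Casselman, *Introduction to the theory of admissible representations of p-adic reductive groups* (1995), Prop. 7.1.3 p. 67, Cor. 7.1.2, Thm. 3.2.4.
* [BernsteinZelevinsky1976] I. N. Bernstein, A. V. Zelevinsky, Russian Math. Surveys 31:3 (1976), 2.25 (c).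
* [BernsteinZelevinsky1977] I. N. Bernstein, A. V. Zelevinsky, Ann. Sci. ÉNS 10 (1977), Prop. 1.9 (b), Thm. 2.9.
-/

set_option autoImplicit false
-- the mandated namespace has the single-problem summit's repeated segment (`HodgeConjecture.HodgeConjecture`)
set_option linter.dupNamespace false

noncomputable section

open NumberField IsDedekindDomain
open scoped Matrix
open Literature.NumberTheory.Rogawski1990 Literature.NumberTheory.Automorphic Literature.NumberTheory.Automorphic.UnitaryGroup
open Literature.RepresentationTheory.FiniteGroups

namespace Summit.HodgeConjecture.HodgeConjecture.Cruxes.H413.F0P3cStCharTSLdsRedTwoOfReducible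

/-! ## §1 Linear algebra: `M`-maps out of a line into a line are proportional -/

/-- **Two intertwining maps out of a ONE-DIMENSIONAL representation into a one-dimensional one are proportional** (`ψ₁ ≠ 0 ⇒ ψ₂ = c • ψ₁`): both are linear
functionals on a line.  (The `huniq` hypothesis of ★ Frobenius uniqueness `intertwiningMap_cmPrincipalSeries_eq_smul` when `dim r_B(π) = 1`.)
[cite: Casselman1995, Prop. 7.1.3 p. 67] [cite: BernsteinZelevinsky1977, Prop. 1.9 (b)] -/
theorem intertwiningMap_eq_smul_of_finrank_eq_one {M : Type*} [Group M] {X : Type*} [AddCommGroup X] [Module ℂ X]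
    (r : Representation ℂ M X) (hX : Module.finrank ℂ X = 1) (τ : Representation ℂ M ℂ)
    (ψ₁ ψ₂ : r.IntertwiningMap τ) (h₁ : ψ₁ ≠ 0) : ∃ c : ℂ, ψ₂ = c • ψ₁ := by
  obtain ⟨v₀, hv₀, hspan⟩ := finrank_eq_one_iff'.1 hX
  -- `ψ₁ v₀ ≠ 0`, else `ψ₁ = 0`
  have hψv : ψ₁ v₀ ≠ 0 := by
    intro h0
    apply h₁
    apply Representation.IntertwiningMap.ext
    refine LinearMap.ext fun w => ?_
    obtain ⟨a, rfl⟩ := hspan w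
    rw [Representation.IntertwiningMap.toLinearMap_apply, map_smul, h0, smul_zero]
    rfl
  refine ⟨ψ₂ v₀ * (ψ₁ v₀)⁻¹, ?_⟩
  apply Representation.IntertwiningMap.ext
  refine LinearMap.ext fun w => ?_
  obtain ⟨a, rfl⟩ := hspan w
  rw [Representation.IntertwiningMap.toLinearMap_apply, Representation.IntertwiningMap.toLinearMap_apply,
    Representation.IntertwiningMap.smul_apply, map_smul, map_smul, smul_eq_mul, smul_eq_mul, smul_eq_mul]
  field_simp

/-! ## §2 A reducible semi-regular `i_G(χ₁, χ₂)` has two NON-ISOMORPHIC constituents -/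

section Reducible

variable (L : Type) [Field L] [NumberField L] [IsCMField L] (v : HeightOneSpectrum (𝓞 ↥(maximalRealSubfield L)))
  (hns : ∀ w : PlacesOver L v, IsCMField.complexConj L • w.1 = w.1)

include hns in
set_option synthInstance.maxHeartbeats 400000 in
set_option maxHeartbeats 8000000 in
-- statement∕proof-heavy: the `SmoothInd` carrier of `cmPrincipalSeries`, its subrepresentations and their Jacquet modules (class of ★ UniqPar §2 ∕ ★ JacquetRankStrictMono §3)
/-- **«LDS-RED-TWO ⟸ KEYS-RED-(3)★», the core: a REDUCIBLE semi-regular unitary `i_G(χ₁, χ₂)` has two DISTINCT constituents.**  At a non-split `v`, for continuous `χ₁, χ₂`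
with `χ₁|_{F_v^×} = 1`: if `i_G(χ₁, χ₂)` has a `G`-stable `⊥ ≠ N ≠ ⊤`, then it has constituents `c₁ ≠ c₂` — namely `⟦N⟧` and `⟦N'⟧` for the invariant complement `N'` of the
semisimple `i_G(χ₁, χ₂)` (★ «PS-UNITARY★»), both irreducible (★ N3), and NON-ISOMORPHIC by Frobenius uniqueness on the line `r_B(N)` (★ [Casselman1995, Prop. 7.1.3]): two
proportional embeddings `N ↪ i_G(χ)` cannot land in the complementary `N` and `N'`.
[cite: Rogawski1990, §12.2 p. 173 ll. 8–12; §12.2 (3) pp. 173–174] [cite: Keys1984, §7 Thm. (1) p. 126] [cite: Casselman1995, Prop. 7.1.3 p. 67] [cite: BernsteinZelevinsky1977, Prop. 1.9 (b)] -/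
theorem two_constituents_of_reducible
    (χ₁ : (LocalRing L v)ˣ →* ℂˣ) (χ₂ : ↥(normOneUnits (conjLocal L (IsCMField.complexConj L) v)) →* ℂˣ)
    (h1 : Continuous (fun x => ((χ₁ x : ℂˣ) : ℂ))) (h2 : Continuous (fun x => ((χ₂ x : ℂˣ) : ℂ)))
    (htriv : ∀ a : (LocalRing L v)ˣ, (conjLocal L (IsCMField.complexConj L) v) (a : LocalRing L v) = a → χ₁ a = 1)
    (hred : ∃ N : Subrepresentation (cmPrincipalSeries L 3 v (cmTorusCharPair L v χ₁ χ₂)), N ≠ ⊥ ∧ N ≠ ⊤) :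
    ∃ c₁ c₂ : IrrClass (Gqs L v), c₁ ≠ c₂ ∧ c₁.IsConstituentOf (cmPrincipalSeries L 3 v (cmTorusCharPair L v χ₁ χ₂)) ∧
      c₂.IsConstituentOf (cmPrincipalSeries L 3 v (cmTorusCharPair L v χ₁ χ₂)) := by
  haveI := locallyCompactSpace_cmBorelU L 3 v
  obtain ⟨N, hNb, hNt⟩ := hred
  -- (U) complete reducibility ⇒ an invariant complement `N'`, again `⊥ ≠ N' ≠ ⊤`
  haveI := F0P3cStCharTSPrincipalSeriesUnitary.isSemisimpleRepresentation_cmPrincipalSeries_cmTorusCharPair L v hns χ₁ χ₂ h1 h2 htriv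
  obtain ⟨N', hc⟩ := exists_isCompl N
  have hN'b : N' ≠ ⊥ := fun h => hNt (eq_top_of_isCompl_bot (h ▸ hc))
  have hN't : N' ≠ ⊤ := fun h => hNb (eq_bot_of_isCompl_top (h ▸ hc))
  -- no 3-chain ⇒ `N`, `N'` irreducible; smoothness
  have hlen := F0P3U3PrincipalSeriesLettersHold.u3PrincipalSeriesLengthLeTwo_holds L v hns χ₁ χ₂ h1 h2
  have hsm := F0P3U3LengthLeTwoOfEmbeds.isSmooth_cmPrincipalSeries L v (cmTorusCharPair L v χ₁ χ₂)
  have hNirr := IrrClass.isIrreducible_toRepresentation_of_forall_not_lt_lt hlen hNb hNt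
  have hN'irr := IrrClass.isIrreducible_toRepresentation_of_forall_not_lt_lt hlen hN'b hN't
  let r₁ : SmoothIrrep (Gqs L v) := SmoothIrrep.mk ↥N.toSubmodule N.toRepresentation hNirr (hsm.toRepresentation N)
  let r₂ : SmoothIrrep (Gqs L v) := SmoothIrrep.mk ↥N'.toSubmodule N'.toRepresentation hN'irr (hsm.toRepresentation N')
  refine ⟨IrrClass.mk r₁, IrrClass.mk r₂, ?_, (IrrClass.isConstituentOf_mk_self r₁).of_subrepresentation N,
    (IrrClass.isConstituentOf_mk_self r₂).of_subrepresentation N'⟩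
  intro heq
  obtain ⟨e⟩ := (IrrClass.mk_eq_mk_iff r₁ r₂).1 heq
  -- `dim r_B(N) = 1` [Casselman1995, Prop. 7.1.3]: ★ N1 (`dim r_B(I) = 2`), ★ N2 (constituents have `r_B ≠ 0`), exactness (★ `isLimitOfCompactOpen_cmUnipotentU`)
  have key := finiteDimensional_finrank_eq_two_of_U3PrincipalSeriesJacquetFiltration L
    (F0P3U3PrincipalSeriesJacquetFiltrationHolds.U3PrincipalSeriesJacquetFiltration_holds L) v hns χ₁ χ₂ h1 h2
  haveI := key.1
  have hfin : Module.finrank ℂ ((cmBorelTriple L 3 v).restrict N.toRepresentation).Coinvariants = 1 :=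
    Representation.finrank_coinvariants_eq_one_of_ne_bot_of_ne_top (cmBorelTriple L 3 v)
      (F0P3UnipotentLimitCompactOpen.isLimitOfCompactOpen_cmUnipotentU L v) hsm
      (F0P3U3LengthLeTwoOfEmbeds.nontrivial_coinvariants_of_isConstituentOf_cmPrincipalSeries L
        (F0P3U3PrincipalSeriesLettersHold.u3PrincipalSeriesConstituentEmbeds_holds L) v hns χ₁ χ₂ h1 h2)
      key.2 hNb hNt
  -- Frobenius uniqueness on `N`: any two `G`-maps `N → i_G(χ)` are proportional
  have huniq : ∀ ψ₁ ψ₂ : (N.toRepresentation.normalizedJacquet (cmBorelTriple L 3 v)).IntertwiningMap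
      ((Representation.trivial ℂ ↥(cmBorelTriple L 3 v).M ℂ).twist (cmTorusCharPair L v χ₁ χ₂)), ψ₁ ≠ 0 → ∃ c : ℂ, ψ₂ = c • ψ₁ :=
    fun ψ₁ ψ₂ hψ₁ => intertwiningMap_eq_smul_of_finrank_eq_one _ hfin _ ψ₁ ψ₂ hψ₁
  let B₁ : N.toRepresentation.IntertwiningMap (cmPrincipalSeries L 3 v (cmTorusCharPair L v χ₁ χ₂)) := Subrepresentation.subtypeIntertwiningMap N
  let B₂ : N.toRepresentation.IntertwiningMap (cmPrincipalSeries L 3 v (cmTorusCharPair L v χ₁ χ₂)) :=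
    (Subrepresentation.subtypeIntertwiningMap N').comp e.toIntertwiningMap
  have hB₁ : B₁ ≠ 0 := Subrepresentation.subtypeIntertwiningMap_ne_zero hNb
  obtain ⟨c, hcB⟩ := F0P2pCmPrincipalSeriesInterface.intertwiningMap_cmPrincipalSeries_eq_smul L v (cmTorusCharPair L v χ₁ χ₂)
    N.toRepresentation (hsm.toRepresentation N) huniq B₁ B₂ hB₁
  -- the contradiction: for `0 ≠ n ∈ N`, `e n = c • n ∈ N ⊓ N' = ⊥`, so `e n = 0` with `e` injective
  have hNb' : N.toSubmodule ≠ ⊥ := fun h => hNb (Subrepresentation.toSubmodule_injective h)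
  obtain ⟨n, hnN, hn0⟩ := Submodule.exists_mem_ne_zero_of_ne_bot hNb'
  -- read the proportionality at `⟨n, hnN⟩`: `B₂ ⟨n, hnN⟩ = ↑(e ⟨n, hnN⟩)` and `B₁ ⟨n, hnN⟩ = n` (definitional)
  have hval : ((e.toIntertwiningMap ⟨n, hnN⟩ : ↥N'.toSubmodule) : Representation.SmoothInd (cmBorelTriple L 3 v).P
      (Representation.twist (((Representation.trivial ℂ ↥(torusU (conjLocal L (IsCMField.complexConj L) v) (cmLocalForm L 3 v)) ℂ).twist
        (cmTorusCharPair L v χ₁ χ₂)).comp (cmBorelTriple L 3 v).proj) (rootDeltaChar (cmBorelTriple L 3 v).P))) = c • n :=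
    congrArg (fun B : N.toRepresentation.IntertwiningMap (cmPrincipalSeries L 3 v (cmTorusCharPair L v χ₁ χ₂)) => B ⟨n, hnN⟩) hcB
  have hmemN : ((e.toIntertwiningMap ⟨n, hnN⟩ : ↥N'.toSubmodule) : Representation.SmoothInd (cmBorelTriple L 3 v).P
      (Representation.twist (((Representation.trivial ℂ ↥(torusU (conjLocal L (IsCMField.complexConj L) v) (cmLocalForm L 3 v)) ℂ).twist
        (cmTorusCharPair L v χ₁ χ₂)).comp (cmBorelTriple L 3 v).proj) (rootDeltaChar (cmBorelTriple L 3 v).P))) ∈ N := by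
    rw [hval]
    exact N.toSubmodule.smul_mem c hnN
  have hmem : ((e.toIntertwiningMap ⟨n, hnN⟩ : ↥N'.toSubmodule) : Representation.SmoothInd (cmBorelTriple L 3 v).P
      (Representation.twist (((Representation.trivial ℂ ↥(torusU (conjLocal L (IsCMField.complexConj L) v) (cmLocalForm L 3 v)) ℂ).twist
        (cmTorusCharPair L v χ₁ χ₂)).comp (cmBorelTriple L 3 v).proj) (rootDeltaChar (cmBorelTriple L 3 v).P))) ∈
      (N ⊓ N' : Subrepresentation (cmPrincipalSeries L 3 v (cmTorusCharPair L v χ₁ χ₂))) :=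
    ⟨hmemN, (e.toIntertwiningMap ⟨n, hnN⟩).2⟩
  rw [disjoint_iff.1 hc.disjoint] at hmem
  have hmem' : ((e.toIntertwiningMap ⟨n, hnN⟩ : ↥N'.toSubmodule) : Representation.SmoothInd (cmBorelTriple L 3 v).P
      (Representation.twist (((Representation.trivial ℂ ↥(torusU (conjLocal L (IsCMField.complexConj L) v) (cmLocalForm L 3 v)) ℂ).twist
        (cmTorusCharPair L v χ₁ χ₂)).comp (cmBorelTriple L 3 v).proj) (rootDeltaChar (cmBorelTriple L 3 v).P))) ∈
      (⊥ : Subrepresentation (cmPrincipalSeries L 3 v (cmTorusCharPair L v χ₁ χ₂))).toSubmodule := hmem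
  have hy0 : e.toIntertwiningMap ⟨n, hnN⟩ = 0 := Subtype.ext ((Submodule.mem_bot ℂ).1 hmem')
  have hinj : Function.Injective e.toIntertwiningMap := e.toLinearEquiv.injective
  have hn : (⟨n, hnN⟩ : ↥N.toSubmodule) = 0 := hinj (hy0.trans (map_zero _).symm)
  exact hn0 (congrArg Subtype.val hn)

/-! ## §3 RUNG 0's `hLdsRedTwo` binder VERBATIM ⟺ the re-lettered named input «KEYS-RED-(3)» (reducibility alone) -/

include hns in
set_option synthInstance.maxHeartbeats 400000 in
set_option maxHeartbeats 8000000 in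
-- statement-heavy: two ∀-closed binder texts over the `SmoothInd` carrier (class of ★ LdsTwoOfTwo §3)
/-- **RUNG 0's named input `hLdsRedTwo` (text of ★ `F0P3cStCharTSRung0Five.ellipticPackage_hyps_of_namedBlock₅` :129, VERBATIM) FROM «KEYS-RED-(3)»** — Keys' reducibility of the
unitary `i_G(χ₁, χ₂)` at `χ₁|_{F_v^×} = 1`, `χ₁ ≠ 1` [Keys1984 §7 Thm. (1); Rogawski1990 §12.2 (3)], in the antecedent shape of RUNG 0's `hKeysRed` (`∃ N, N ≠ ⊥ ∧ N ≠ ⊤`).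
The consuming RUNG 0 edition writes `hLdsRedTwo := ldsRedTwo_of_keysRedThree L v hns hKeysRed3`; the print residue of «LDS-TWO» shrinks from (R1)+(R2) to (R1) alone.
[cite: Rogawski1990, §12.2 p. 173 ll. 8–12; §12.2 (3) pp. 173–174] [cite: Keys1984, §7 Thm. (1) p. 126] [cite: Casselman1995, Prop. 7.1.3 p. 67] -/
theorem ldsRedTwo_of_keysRedThree
    (hKeysRed3 :
      ∀ (χ₁ : (UnitaryGroup.LocalRing L v)ˣ →* ℂˣ) (χ₂ : ↥(normOneUnits (conjLocal L (IsCMField.complexConj L) v)) →* ℂˣ), Continuous (fun x => ((χ₁ x : ℂˣ) : ℂ)) → Continuous (fun x => ((χ₂ x : ℂˣ) : ℂ)) → (∀ a : (UnitaryGroup.LocalRing L v)ˣ, (conjLocal L (IsCMField.complexConj L) v) (a : UnitaryGroup.LocalRing L v) = a → χ₁ a = 1) → χ₁ ≠ 1 → ∃ N : Subrepresentation (UnitaryGroup.cmPrincipalSeries L 3 v (UnitaryGroup.cmTorusCharPair L v χ₁ χ₂)), N ≠ ⊥ ∧ N ≠ ⊤) :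
    (∀ (χ₁ : (UnitaryGroup.LocalRing L v)ˣ →* ℂˣ) (χ₂ : ↥(normOneUnits (conjLocal L (IsCMField.complexConj L) v)) →* ℂˣ), Continuous (fun x => ((χ₁ x : ℂˣ) : ℂ)) → Continuous (fun x => ((χ₂ x : ℂˣ) : ℂ)) → (∀ a : (UnitaryGroup.LocalRing L v)ˣ, (conjLocal L (IsCMField.complexConj L) v) (a : UnitaryGroup.LocalRing L v) = a → χ₁ a = 1) → χ₁ ≠ 1 → ∃ c₁ c₂ : IrrClass (Gqs L v), c₁ ≠ c₂ ∧ c₁.IsConstituentOf (UnitaryGroup.cmPrincipalSeries L 3 v (UnitaryGroup.cmTorusCharPair L v χ₁ χ₂)) ∧ c₂.IsConstituentOf (UnitaryGroup.cmPrincipalSeries L 3 v (UnitaryGroup.cmTorusCharPair L v χ₁ χ₂))) :=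
  fun χ₁ χ₂ h1 h2 htriv hne1 => two_constituents_of_reducible L v hns χ₁ χ₂ h1 h2 htriv (hKeysRed3 χ₁ χ₂ h1 h2 htriv hne1)

set_option synthInstance.maxHeartbeats 400000 in
set_option maxHeartbeats 8000000 in
-- statement-heavy (as above)
/-- **Conversely, «KEYS-RED-(3)» FROM RUNG 0's `hLdsRedTwo`**: two distinct constituents make `i_G(χ₁, χ₂)` reducible (★ `exists_ne_bot_ne_top_of_isConstituentOf_ne`) — the
re-lettering is an equivalence, hence honesty-neutral. [cite: Rogawski1990, §12.2 p. 173 ll. 8–12] [cite: Keys1984, §7 Thm. (1) p. 126] -/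
theorem keysRedThree_of_ldsRedTwo
    (hLdsRedTwo :
      ∀ (χ₁ : (UnitaryGroup.LocalRing L v)ˣ →* ℂˣ) (χ₂ : ↥(normOneUnits (conjLocal L (IsCMField.complexConj L) v)) →* ℂˣ), Continuous (fun x => ((χ₁ x : ℂˣ) : ℂ)) → Continuous (fun x => ((χ₂ x : ℂˣ) : ℂ)) → (∀ a : (UnitaryGroup.LocalRing L v)ˣ, (conjLocal L (IsCMField.complexConj L) v) (a : UnitaryGroup.LocalRing L v) = a → χ₁ a = 1) → χ₁ ≠ 1 → ∃ c₁ c₂ : IrrClass (Gqs L v), c₁ ≠ c₂ ∧ c₁.IsConstituentOf (UnitaryGroup.cmPrincipalSeries L 3 v (UnitaryGroup.cmTorusCharPair L v χ₁ χ₂)) ∧ c₂.IsConstituentOf (UnitaryGroup.cmPrincipalSeries L 3 v (UnitaryGroup.cmTorusCharPair L v χ₁ χ₂))) :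
    (∀ (χ₁ : (UnitaryGroup.LocalRing L v)ˣ →* ℂˣ) (χ₂ : ↥(normOneUnits (conjLocal L (IsCMField.complexConj L) v)) →* ℂˣ), Continuous (fun x => ((χ₁ x : ℂˣ) : ℂ)) → Continuous (fun x => ((χ₂ x : ℂˣ) : ℂ)) → (∀ a : (UnitaryGroup.LocalRing L v)ˣ, (conjLocal L (IsCMField.complexConj L) v) (a : UnitaryGroup.LocalRing L v) = a → χ₁ a = 1) → χ₁ ≠ 1 → ∃ N : Subrepresentation (UnitaryGroup.cmPrincipalSeries L 3 v (UnitaryGroup.cmTorusCharPair L v χ₁ χ₂)), N ≠ ⊥ ∧ N ≠ ⊤) := by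
  intro χ₁ χ₂ h1 h2 htriv hne1
  obtain ⟨c₁, c₂, hne, hc₁, hc₂⟩ := hLdsRedTwo χ₁ χ₂ h1 h2 htriv hne1
  exact F0P3bPrincipalSeriesTrace.exists_ne_bot_ne_top_of_isConstituentOf_ne hc₁ hc₂ hne

include hns in
set_option synthInstance.maxHeartbeats 400000 in
set_option maxHeartbeats 8000000 in
-- statement-heavy (as above)
/-- **«LDS-RED-TWO» ⟺ «KEYS-RED-(3)»** at a non-split `v` (the two directions above): RUNG 0's named input `hLdsRedTwo` and Keys' reducibility statement for case (3) say the same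
thing in the tree — the in-house content being (U) ★ «PS-UNITARY★» + (R2) `two_constituents_of_reducible`. [cite: Rogawski1990, §12.2 p. 173 ll. 8–12; §12.2 (3) pp. 173–174]
[cite: Keys1984, §7 Thm. (1) p. 126] -/
theorem ldsRedTwo_iff_keysRedThree :
    (∀ (χ₁ : (UnitaryGroup.LocalRing L v)ˣ →* ℂˣ) (χ₂ : ↥(normOneUnits (conjLocal L (IsCMField.complexConj L) v)) →* ℂˣ), Continuous (fun x => ((χ₁ x : ℂˣ) : ℂ)) → Continuous (fun x => ((χ₂ x : ℂˣ) : ℂ)) → (∀ a : (UnitaryGroup.LocalRing L v)ˣ, (conjLocal L (IsCMField.complexConj L) v) (a : UnitaryGroup.LocalRing L v) = a → χ₁ a = 1) → χ₁ ≠ 1 → ∃ c₁ c₂ : IrrClass (Gqs L v), c₁ ≠ c₂ ∧ c₁.IsConstituentOf (UnitaryGroup.cmPrincipalSeries L 3 v (UnitaryGroup.cmTorusCharPair L v χ₁ χ₂)) ∧ c₂.IsConstituentOf (UnitaryGroup.cmPrincipalSeries L 3 v (UnitaryGroup.cmTorusCharPair L v χ₁ χ₂))) ↔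
    (∀ (χ₁ : (UnitaryGroup.LocalRing L v)ˣ →* ℂˣ) (χ₂ : ↥(normOneUnits (conjLocal L (IsCMField.complexConj L) v)) →* ℂˣ), Continuous (fun x => ((χ₁ x : ℂˣ) : ℂ)) → Continuous (fun x => ((χ₂ x : ℂˣ) : ℂ)) → (∀ a : (UnitaryGroup.LocalRing L v)ˣ, (conjLocal L (IsCMField.complexConj L) v) (a : UnitaryGroup.LocalRing L v) = a → χ₁ a = 1) → χ₁ ≠ 1 → ∃ N : Subrepresentation (UnitaryGroup.cmPrincipalSeries L 3 v (UnitaryGroup.cmTorusCharPair L v χ₁ χ₂)), N ≠ ⊥ ∧ N ≠ ⊤) :=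
  ⟨keysRedThree_of_ldsRedTwo L v, ldsRedTwo_of_keysRedThree L v hns⟩

end Reducible

end Summit.HodgeConjecture.HodgeConjecture.Cruxes.H413.F0P3cStCharTSLdsRedTwoOfReducible

end
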